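import Summits.QuantumFields.YangMills.Theorems.BalabanUVNodesN15KingModelCoverLifts
import Literature.MathematicalPhysics.QuantumFieldTheory.King1986.TorusBlockForm
import Literature.MathematicalPhysics.QuantumFieldTheory.Balaban1983to89.B5Block118
import HarnessLib

/-!
# BalabanUVNodes ∕ N15 — THE KING-MODEL RUNG (PART Ͻ-b): FINITE COVERS — THE COVERING PROJECTIONS `T_{K′} → T_K` (`K_μ ∣ K′_μ`) OF KING's TORI, their sections, and their
# compatibility with the lattice letters (unit vectors, King's blocks `B(y)`, the unit-lattice embedding `y ↦ Ny`, block offsets, `blockOf`)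
# (Track A, DAG node N15 = NE2; FAN-OUT v1.1 §N15 s3 «KING-MODEL RUNG … + what the curved case adds»; count-neutral)

HONEST FRAMING.  Count-neutral (cell `pub-ymgap`, seat `pub-ymgap-dag-n15-e` g45; `--supports stmt-QuantumFields-27247 --as helper` = K3ᴬ, KEY MAP v3).  Elementary arithmetic of
the finite tori `T_K = Π_μℤ∕K_μ` (`B5Prop11Plancherel.Tor`, [Balaban1984PropagatorsI] (1.29) p.23) on which King's `A = 0` model [King1986] lives in this programme.  When
`K_μ ∣ K′_μ` for every `μ`, reduction modulo `K_μ` in each coordinate is a COVERING MAP `T_{K′} → T_K` (a group homomorphism with fibres the cosets of `K·ℤ^{d}∕K′·ℤ^{d}`); King's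
block geometry (blocks of side `N`, the unit lattice `T_M` under the fine lattice `T_{NM}`, [King1986] (2.10)–(2.12) p.653, (4.1)–(4.3) p.670) is compatible with it: the cover of the
fine torus over the cover of the unit torus is again King's two-level structure.  This file supplies exactly these compatibilities; PART Ͻ-c…Ͻ-h use them to descend King's
operators (PART Ͻ-a `Lifts`).  NOT Bałaban's `G_k(U)`; NOT a node discharge; nothing continuum ∕ ℝ⁴ ∕ OS ∕ Clay.

PROVED HERE ([folklore] throughout):
* §1 `proj h : Tor K′ → Tor K` (componentwise `ZMod.castHom`), `proj_apply_val` (`= x_μ.val mod K_μ`), additivity (`proj_add`, `proj_neg`, `proj_sub`, `proj_zero`, `proj_nsmul`), the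
  section `lift h` (`proj_lift`, ★ `proj_surjective`), ★ `proj_unitVec` ∕ `proj_tstep` (lattice steps descend to lattice steps), `proj_refl`∕`proj_trans` (functoriality);
* §2 KING's TWO-LEVEL STRUCTURE: `fineDvd N h : fine N M ∣ fine N M′` coordinatewise, ★ `proj_up` (`π(N·ỹ) = N·π(ỹ)`), `proj_iota` (offsets are preserved), ★★ **`proj_bpt`** (the block
  point `Nỹ + j` over `ỹ` projects to the block point `Nπ(ỹ) + j` — King's blocks descend to King's blocks), `proj_site`, ★★ **`blockOf_proj`** (`blockOf ∘ π_fine = π_coarse ∘ blockOf`),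
  `proj_bpt_eq_iff` (a cover block point lies over a base block point iff the blocks correspond and the offsets agree).
PRIOR TREE ART (by name): `B5Prop11Plancherel` (`Tor`, `unitVec`, `fine`), `B5Block118` (`tstep`, `up`, `upHom_intCast`, `iota`, `bpt`), `King1986.Torus` (`site`, `blockEquiv`, `blockOf`,
`blockOf_site`, `site_eq_bpt`, `site_injective`), Mathlib (`ZMod.castHom`, `ZMod.cast_natCast`, `ZMod.natCast_zmod_val`).  Dedup (rg at filing): basename 0 files; needles
`proj_bpt|blockOf_proj|fineDvd|proj_unitVec` 0 tree files (the tree's `King1986.TorusCongr` transports along EQUAL periods, not along divisibility).  presearch: n/a (elementary).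
Locators: [King1986] (2.10)–(2.12) p.653, (4.1)–(4.3) p.670; [Balaban1984PropagatorsI] (1.6) p.18, (1.18)∕(1.20) p.20, (1.29) p.23.  0 `sorry`, 3 `def`.
-/

noncomputable section

open scoped BigOperators
open Finset

namespace Summit.QuantumFields.YangMills.BalabanUVNodes.N15KingModelRung.Cover

open Literature.MathematicalPhysics.QuantumFieldTheory.Balaban1983to89.B5Prop11Plancherel (Tor unitVec fine)
open Literature.MathematicalPhysics.QuantumFieldTheory.Balaban1983to89.B5Block118 (tstep up upHom_intCast iota bpt)
open Literature.MathematicalPhysics.QuantumFieldTheory.King1986.Torus (site blockEquiv blockOf blockOf_site site_eq_bpt site_injective)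

variable {d : ℕ} {K K' K'' : Fin d → ℕ}

/-! ## §1 The covering projection and its section -/

/-- THE COVERING PROJECTION `T_{K′} → T_K` for `K_μ ∣ K′_μ`: reduce each coordinate modulo `K_μ`. [folklore] -/
def proj [∀ μ, NeZero (K μ)] (h : ∀ μ, K μ ∣ K' μ) (x : Tor K') : Tor K :=
  fun μ => ZMod.castHom (h μ) (ZMod (K μ)) (x μ)

variable [hK : ∀ μ, NeZero (K μ)]

/-- Coordinates of the projection. [folklore] -/
theorem proj_apply (h : ∀ μ, K μ ∣ K' μ) (x : Tor K') (μ : Fin d) : proj h x μ = ZMod.castHom (h μ) (ZMod (K μ)) (x μ) := rfl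

/-- The projection in residues: `π(x)_μ = (x_μ.val : ℤ∕K_μ)`. [folklore] -/
theorem proj_apply_val [∀ μ, NeZero (K' μ)] (h : ∀ μ, K μ ∣ K' μ) (x : Tor K') (μ : Fin d) : proj h x μ = (((x μ).val : ℕ) : ZMod (K μ)) := by
  rw [proj_apply, ZMod.castHom_apply, ZMod.cast_eq_val]

/-- `π` is additive. [folklore] -/
theorem proj_add (h : ∀ μ, K μ ∣ K' μ) (x y : Tor K') : proj h (x + y) = proj h x + proj h y := by
  funext μ; simp only [proj_apply, Pi.add_apply, map_add]

/-- `π 0 = 0`. [folklore] -/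
theorem proj_zero (h : ∀ μ, K μ ∣ K' μ) : proj h (0 : Tor K') = 0 := by
  funext μ; simp only [proj_apply, Pi.zero_apply, map_zero]

/-- `π(−x) = −π(x)`. [folklore] -/
theorem proj_neg (h : ∀ μ, K μ ∣ K' μ) (x : Tor K') : proj h (-x) = -proj h x := by
  funext μ; simp only [proj_apply, Pi.neg_apply, map_neg]

/-- `π(x − y) = π(x) − π(y)`. [folklore] -/
theorem proj_sub (h : ∀ μ, K μ ∣ K' μ) (x y : Tor K') : proj h (x - y) = proj h x - proj h y := by
  funext μ; simp only [proj_apply, Pi.sub_apply, map_sub]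

/-- `π(n•x) = n•π(x)`. [folklore] -/
theorem proj_nsmul (h : ∀ μ, K μ ∣ K' μ) (n : ℕ) (x : Tor K') : proj h (n • x) = n • proj h x := by
  funext μ; simp only [proj_apply, Pi.smul_apply, map_nsmul]

/-- THE SECTION `T_K → T_{K′}`: the representative with the same residues `x_μ.val`. [folklore] -/
def lift (_h : ∀ μ, K μ ∣ K' μ) (y : Tor K) : Tor K' := fun μ => (((y μ).val : ℕ) : ZMod (K' μ))

/-- `π ∘ lift = id`. [folklore] -/
theorem proj_lift (h : ∀ μ, K μ ∣ K' μ) (y : Tor K) : proj h (lift h y) = y := by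
  funext μ
  rw [proj_apply, lift, ZMod.castHom_apply, ZMod.cast_natCast (h μ), ZMod.natCast_zmod_val]

/-- ★ The covering projection is SURJECTIVE. [folklore] -/
theorem proj_surjective (h : ∀ μ, K μ ∣ K' μ) : Function.Surjective (proj h) :=
  fun y => ⟨lift h y, proj_lift h y⟩

/-- ★ LATTICE STEPS DESCEND: `π(e_μ) = e_μ`. [folklore] -/
theorem proj_unitVec (h : ∀ μ, K μ ∣ K' μ) (μ : Fin d) : proj h (unitVec K' μ) = unitVec K μ := by
  funext ν
  rw [proj_apply, unitVec, unitVec]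
  by_cases hν : ν = μ
  · subst hν; rw [Pi.single_eq_same, Pi.single_eq_same, map_one]
  · rw [Pi.single_eq_of_ne hν, Pi.single_eq_of_ne hν, map_zero]

/-- `π(t·e_μ) = t·e_μ`. [folklore] -/
theorem proj_tstep (h : ∀ μ, K μ ∣ K' μ) (μ : Fin d) (t : ℕ) : proj h (tstep K' μ t) = tstep K μ t := by
  funext ν
  rw [proj_apply, tstep, tstep]
  by_cases hν : ν = μ
  · rw [if_pos hν, if_pos hν, map_natCast]
  · rw [if_neg hν, if_neg hν, map_zero]

/-- `π(x ± e_μ) = π(x) ± e_μ` (forward neighbours descend). [folklore] -/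
theorem proj_add_unitVec (h : ∀ μ, K μ ∣ K' μ) (x : Tor K') (μ : Fin d) : proj h (x + unitVec K' μ) = proj h x + unitVec K μ := by
  rw [proj_add, proj_unitVec]

/-- Backward neighbours descend. [folklore] -/
theorem proj_sub_unitVec (h : ∀ μ, K μ ∣ K' μ) (x : Tor K') (μ : Fin d) : proj h (x - unitVec K' μ) = proj h x - unitVec K μ := by
  rw [proj_sub, proj_unitVec]

/-- The trivial cover: `π = id` along `K ∣ K`. [folklore] -/
theorem proj_refl (x : Tor K) : proj (fun μ => dvd_refl (K μ)) x = x := by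
  funext μ
  rw [proj_apply_val, ZMod.natCast_zmod_val]

/-- FUNCTORIALITY: projecting `T_{K″} → T_{K′} → T_K` is projecting `T_{K″} → T_K`. [folklore] -/
theorem proj_trans [∀ μ, NeZero (K' μ)] [∀ μ, NeZero (K'' μ)] (h : ∀ μ, K μ ∣ K' μ) (h' : ∀ μ, K' μ ∣ K'' μ) (x : Tor K'') :
    proj h (proj h' x) = proj (fun μ => dvd_trans (h μ) (h' μ)) x := by
  funext μ
  rw [proj_apply_val, proj_apply_val, proj_apply_val, ZMod.val_natCast, ZMod.natCast_eq_natCast_iff', Nat.mod_mod_of_dvd _ (h μ)]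

/-- A pulled-back function is constant on fibres: `f(π x̃)` only depends on `π x̃`. (Bookkeeping form used by the descent files.) [folklore] -/
theorem comp_proj_apply (h : ∀ μ, K μ ∣ K' μ) {S : Type*} (f : Tor K → S) (x : Tor K') : (f ∘ proj h) x = f (proj h x) := rfl

/-! ## §2 King's two-level structure descends -/

section TwoLevel

variable (N : ℕ) [NeZero N] {M M' : Fin d → ℕ} [hM : ∀ μ, NeZero (M μ)] [hM' : ∀ μ, NeZero (M' μ)]

omit [NeZero N] hM hM' in
/-- The fine lattices inherit the divisibility: `N·M_μ ∣ N·M′_μ`. [folklore] -/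
theorem fineDvd (h : ∀ μ, M μ ∣ M' μ) : ∀ μ, fine N M μ ∣ fine N M' μ := fun μ => mul_dvd_mul_left N (h μ)

/-- ★ THE UNIT-LATTICE EMBEDDING DESCENDS: `π_fine(N·ỹ) = N·π(ỹ)` (King's `y ↦ Ny`, [King1986] (4.1)–(4.3) p.670; B5's `up`). [folklore] -/
theorem proj_up (h : ∀ μ, M μ ∣ M' μ) (y : Tor M') : proj (fineDvd N h) (up N M' y) = up N M (proj h y) := by
  funext ν
  have hy : y ν = ((((y ν).val : ℕ) : ℤ) : ZMod (M' ν)) := by rw [Int.cast_natCast, ZMod.natCast_zmod_val]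
  have hpy : proj h y ν = ((((y ν).val : ℕ) : ℤ) : ZMod (M ν)) := by rw [Int.cast_natCast, proj_apply_val]
  rw [proj_apply, up, up, hpy, upHom_intCast, ZMod.castHom_apply]
  conv_lhs => rw [hy, upHom_intCast]
  rw [ZMod.cast_mul (fineDvd N h ν), ZMod.cast_natCast (fineDvd N h ν), ZMod.cast_intCast (fineDvd N h ν)]

omit hM' in
/-- BLOCK OFFSETS ARE PRESERVED: `π_fine(j) = j` for `j ∈ [0,N)^{d}`. [folklore] -/
theorem proj_iota (h : ∀ μ, M μ ∣ M' μ) (j : Fin d → Fin N) : proj (fineDvd N h) (iota N M' j) = iota N M j := by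
  funext ν
  rw [proj_apply, iota, iota, map_natCast]

/-- ★★ **KING's BLOCKS DESCEND TO KING's BLOCKS**: the block point `N·ỹ + j` of the cover projects to the block point `N·π(ỹ) + j` of the base ([King1986] `B_k(y)` p.653;
B5 (1.6) p.18). [folklore] -/
theorem proj_bpt (h : ∀ μ, M μ ∣ M' μ) (y : Tor M') (j : Fin d → Fin N) :
    proj (fineDvd N h) (bpt N M' y j) = bpt N M (proj h y) j := by
  rw [bpt, bpt, proj_add, proj_up N h, proj_iota N h]

/-- The same for King's `site` spelling (`site = bpt`, tree bridge `site_eq_bpt`). [folklore] -/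
theorem proj_site (h : ∀ μ, M μ ∣ M' μ) (y : Tor M') (j : Fin d → Fin N) :
    proj (fineDvd N h) (site N M' y j) = site N M (proj h y) j := by
  rw [site_eq_bpt, site_eq_bpt, proj_bpt N h]

/-- ★★ **`blockOf` COMMUTES WITH THE PROJECTIONS**: the block of the projected fine point is the projection of the block. [folklore] -/
theorem blockOf_proj (h : ∀ μ, M μ ∣ M' μ) (x : Tor (fine N M')) :
    blockOf N M (proj (fineDvd N h) x) = proj h (blockOf N M' x) := by
  obtain ⟨⟨b, j⟩, rfl⟩ := (blockEquiv N M').surjective x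
  rw [Literature.MathematicalPhysics.QuantumFieldTheory.King1986.Torus.blockEquiv_apply, blockOf_site, proj_site N h, blockOf_site]

/-- A cover block point `N·ỹ + j′` lies over the base block point `N·y + j` iff `π(ỹ) = y` and `j′ = j` (King's block parametrisation is a bijection on both levels). [folklore] -/
theorem proj_bpt_eq_iff (h : ∀ μ, M μ ∣ M' μ) (y' : Tor M') (j' : Fin d → Fin N) (y : Tor M) (j : Fin d → Fin N) :
    proj (fineDvd N h) (bpt N M' y' j') = bpt N M y j ↔ proj h y' = y ∧ j' = j := by
  rw [proj_bpt N h, ← site_eq_bpt, ← site_eq_bpt]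
  constructor
  · intro hh
    have := site_injective N M (a₁ := (proj h y', j')) (a₂ := (y, j)) hh
    exact ⟨congrArg Prod.fst this, congrArg Prod.snd this⟩
  · rintro ⟨h1, h2⟩; rw [h1, h2]

omit hM' in
/-- Every fine point of the base is a block point: `x = N·blockOf(x) + j(x)` (King's block parametrisation, surjective form). [folklore] -/
theorem exists_bpt_eq (x : Tor (fine N M)) : ∃ (y : Tor M) (j : Fin d → Fin N), x = bpt N M y j := by
  obtain ⟨⟨b, j⟩, rfl⟩ := (blockEquiv N M).surjective x
  exact ⟨b, j, by rw [Literature.MathematicalPhysics.QuantumFieldTheory.King1986.Torus.blockEquiv_apply, site_eq_bpt]⟩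

omit hM' in
/-- Block points determine block and offset (injective form). [folklore] -/
theorem bpt_eq_bpt_iff (y y' : Tor M) (j j' : Fin d → Fin N) : bpt N M y j = bpt N M y' j' ↔ y = y' ∧ j = j' := by
  rw [← site_eq_bpt, ← site_eq_bpt]
  constructor
  · intro hh
    have := site_injective N M (a₁ := (y, j)) (a₂ := (y', j')) hh
    exact ⟨congrArg Prod.fst this, congrArg Prod.snd this⟩
  · rintro ⟨h1, h2⟩; rw [h1, h2]

end TwoLevel

end Summit.QuantumFields.YangMills.BalabanUVNodes.N15KingModelRung.Cover

end
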